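import Literature.Analysis.FluidPDE.SereginSverakBlowup
import Literature.Analysis.FluidPDE.NSBoundedInteriorRegularity
import HarnessLib

/-!
# Seregin–Šverák 2009, §4: `InteriorContinuity` from the interior regularity of bounded solutions

`Literature.Analysis.FluidPDE.SereginSverak2009.InteriorContinuity`
(`Literature/Analysis/FluidPDE/SereginSverakBlowup.lean`) transcribes the sentence of
Seregin–Šverák 2009, §4 ¶1 (arXiv:0804.1803, p. 11) "We may also assume that the function `v` is
Hölder continuous in the completion of the set `𝒞 × ]-1,-a²[` for any `0 < a < 1`" in interior
form: a distributional solution `(u, p)` in `Q = 𝒞 × ]-1, 0[` with `u ∈ L³(Q)`, `p ∈ L^{3/2}(Q)`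
and `u ∈ L_∞(𝒞 × ]-1,-a²[)` for every `0 < a < 1` (hypothesis (r2)) agrees a.e. on `Q` with a
function continuous on `Q`. This file PROVES it from the classical named fact
`Literature.Analysis.FluidPDE.NSBoundedInteriorContinuity` (interior continuity of essentially
bounded distributional solutions with `L_{3/2}` pressure in a parabolic cylinder; Seregin–Šverák
2009, §2 p. 8 and App. II (a21)–(a22), resting on [S8] = Seregin 2014 §4.6, [ESS4], [LS], [NRS]):
every point `(t, x)` of `Q` has `t < -a²` for `a = √(-t/2) ∈ ]0, 1[`, hence lies inside a small
parabolic cylinder contained in `Q ∩ {t < -a²}`, on which `u` is essentially bounded by (r2) and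
to which the equations restrict (`Fluid.IsDistributionalNSSolutionOn.of_le`); the local continuous
representatives are glued by `Literature.Analysis.FluidPDE.exists_continuousOn_ae_eq_of_locally`.
The `L³` hypothesis of `InteriorContinuity` is not used (boundedness on the small cylinders is
what the local theorem consumes).

With `NSBoundedInteriorContinuity` reduced in `NSBoundedInteriorRegularity` to
`NSBoundedEnergyClass`, `NSBoundedSpatialHolder` and `NSSliceTimeContinuity`, the discharge
`InteriorContinuity_holds` waits for those three (see that file).

## References

* G. Seregin, V. Šverák, Comm. PDE 34 (2009) = arXiv:0804.1803, §4 ¶1 (p. 11), §2 (p. 8),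
  App. II (a21)–(a22) (p. 14). [`SereginSverak2009`]
* G. Seregin, *Lecture notes on regularity theory for the Navier–Stokes equations* (2014), §4.6
  and §6.5. [`Seregin2014`]
-/

noncomputable section

open MeasureTheory Set Function Filter Topology TopologicalSpace Metric
open scoped NNReal ENNReal

namespace Literature.Analysis.FluidPDE

namespace SereginSverak2009

/-- Local notation for physical space `ℝ³ = EuclideanSpace ℝ (Fin 3)`. -/
local notation "ℝ³" => EuclideanSpace ℝ (Fin 3)

/-- A backward parabolic cylinder whose top centre sits `ρ²/2` above `w` contains `w` and lies in
the centred cylinder `Q*_ρ(w)`. [folklore] -/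
theorem parabolicCylinder_up_subset_centered (ρ : ℝ) (w : ℝ × ℝ³) :
    parabolicCylinder ρ (w.1 + ρ ^ 2 / 2, w.2) ⊆ parabolicCylinderCentered ρ w := by
  intro y hy
  rw [mem_parabolicCylinder] at hy
  rw [mem_parabolicCylinderCentered]
  exact ⟨⟨by nlinarith [hy.1.1, sq_nonneg ρ], by nlinarith [hy.1.2, sq_nonneg ρ]⟩, hy.2⟩

/-- The point `w` lies in the backward cylinder of radius `ρ > 0` with top centre `ρ²/2` above
it. [folklore] -/
theorem mem_parabolicCylinder_up {ρ : ℝ} (hρ : 0 < ρ) (w : ℝ × ℝ³) :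
    w ∈ parabolicCylinder ρ (w.1 + ρ ^ 2 / 2, w.2) := by
  rw [mem_parabolicCylinder, dist_self]
  exact ⟨⟨by nlinarith, by nlinarith⟩, hρ⟩

/-- **Seregin–Šverák 2009, §4 ¶1: `InteriorContinuity` from the interior continuity of bounded
solutions** (arXiv p. 11 with §2 p. 8 and App. II (a21)–(a22) p. 14). Every point `(t, x)` of
`Q = 𝒞 × ]-1, 0[` has `t < -a²` with `a = √(-t/2) ∈ ]0, 1[`; by (r2) `u` is essentially bounded
on `Q ∩ {t < -a²}`, which contains a small parabolic cylinder around `(t, x)`; there the named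
fact `NSBoundedInteriorContinuity` gives a continuous representative, and the representatives are
glued along `Q` (`exists_continuousOn_ae_eq_of_locally`).
[cite: SereginSverak2009, §4 ¶1 (arXiv p. 11) with §2 p. 8 and App. II (a21)–(a22)] -/
theorem interiorContinuity_of (h : NSBoundedInteriorContinuity) : InteriorContinuity := by
  intro u p hsol _hL3 hp hbd
  suffices H : ∃ v : ℝ × ℝ³ → ℝ³, ContinuousOn v (parCyl 0 1) ∧
      uncurry u =ᵐ[volume.restrict (parCyl 0 1)] v from
    H.imp fun v hv => ⟨hv.1, hv.2.symm⟩
  refine exists_continuousOn_ae_eq_of_locally (μ := volume) fun w hw => ?_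
  -- `w = (t, x)` with `-1 < t < 0`; `a = √(-t/2)` has `0 < a < 1` and `t < -a²`
  have ht : w.1 ∈ Ioo (-1 : ℝ) 0 := by
    have := (mem_parCyl_zero.1 hw).1
    simpa using this
  set a : ℝ := Real.sqrt (-w.1 / 2) with ha_def
  have ha2 : a ^ 2 = -w.1 / 2 := Real.sq_sqrt (by linarith [ht.2])
  have ha : a ∈ Ioo (0 : ℝ) 1 := by
    refine ⟨Real.sqrt_pos.2 (by linarith [ht.2]), ?_⟩
    rw [show (1 : ℝ) = Real.sqrt 1 by simp]
    exact Real.sqrt_lt_sqrt (by linarith [ht.2]) (by linarith [ht.1])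
  have hta : w.1 < -a ^ 2 := by rw [ha2]; linarith [ht.2]
  obtain ⟨K, hK⟩ := hbd a ha
  -- a small centred cylinder around `w` inside `Q ∩ {t < -a²}`
  have hWo : IsOpen (parCyl 0 1 ∩ Prod.fst ⁻¹' Iio (-a ^ 2)) :=
    (isOpen_parCyl 0 1).inter (isOpen_Iio.preimage continuous_fst)
  obtain ⟨ρ, hρ, -, hρW⟩ := exists_parabolicCylinderCentered_subset hWo (z := w) ⟨hw, hta⟩
  -- the backward cylinder `V` with top centre `ρ²/2` above `w`
  set z' : ℝ × ℝ³ := (w.1 + ρ ^ 2 / 2, w.2) with hz'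
  have hVW : parabolicCylinder ρ z' ⊆ parCyl 0 1 ∩ Prod.fst ⁻¹' Iio (-a ^ 2) :=
    (parabolicCylinder_up_subset_centered ρ w).trans hρW
  have hVQ : parabolicCylinder ρ z' ⊆ parCyl 0 1 := hVW.trans inter_subset_left
  have hle : parabolicCylinderOpens ρ z' ≤ parCylOpens 0 1 := hVQ
  -- the hypotheses of the local theorem on `V`
  have hbdV : ∀ᵐ y ∂(volume.restrict (parabolicCylinder ρ z')), ‖u y.1 y.2‖ ≤ K := by
    filter_upwards [ae_restrict_of_ae_restrict_of_subset hVQ hK,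
      ae_restrict_mem (isOpen_parabolicCylinder ρ z').measurableSet] with y hy hyV
    exact hy (hVW hyV).2
  have hpV : ∫⁻ y in parabolicCylinder ρ z', ‖p y.1 y.2‖ₑ ^ (3 / 2 : ℝ) < ∞ :=
    (lintegral_mono_set hVQ).trans_lt hp
  obtain ⟨v, hv, huv⟩ := h u p z' ρ K (hsol.of_le hle) hbdV hpV
  exact ⟨parabolicCylinder ρ z', isOpen_parabolicCylinder ρ z', mem_parabolicCylinder_up hρ w,
    hVQ, v, hv, huv⟩

end SereginSverak2009

end Literature.Analysis.FluidPDE
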